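import Summits.BirchSwinnertonDyer.BirchSwinnertonDyer.Theorems.ManinLocalTwoThreeShimuraClassesExact
import Summits.BirchSwinnertonDyer.BirchSwinnertonDyer.Theorems.ManinLocalTwoThreeShimuraClassThreeDescent
import Summits.BirchSwinnertonDyer.BirchSwinnertonDyer.Theorems.ManinLocalTwoThreeShimuraFiveElevenIndex
import Summits.BirchSwinnertonDyer.BirchSwinnertonDyer.Theorems.ManinLocalTwoThreeShimuraEisensteinFiftyTwo
import HarnessLib

/-!
# THE SHIMURA INDEX VALUES `[Λ₀(f) : Λ₁(f)]` AT THE GENUS-ONE LEVELS `11, 17, 20, 24, 27, 32` — for every `f ≠ 0`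
Summit `BirchSwinnertonDyer`, route `ManinLocalTwoThree` (cell bsd-f2-manin, es lens, gen 45, turnkey T-es-107; CANDIDATES rows E-es-257, E-es-258),
cruxes C2 `ManinOddAtFour` (stmt-BirchSwinnertonDyer-22967) / C3 `ManinPrimeToThreeAtNine` (stmt-22968).  Sequel to
`…ShimuraClassesExact` (T-es-104: the class of one cusp symbol has order EXACTLY `2` at `20, 24, 32` and `4` at `17`),
`…ShimuraClassThreeDescent` (T-es-103: order exactly `3` at `27`) and `…ShimuraFiveElevenIndex` (T-es-101: level `11`).
Those files bound the order of ONE class; this file computes the INDEX ITSELF, i.e. the order of the whole quotient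
`Λ₀(f)/Λ₁(f)` (`Λ₀(f) = periodLattice f`, `Λ₁(f) = periodLatticeGamma1 f`), as `AddSubgroup.relIndex`:

* §1 **THE INDEX LEMMA** (`relIndex_eq_of_generator`): if every cusp symbol `{∞, γ∞}_f` is an INTEGER MULTIPLE of one
  period `x` modulo `Λ₁(f)` and `k·x ∈ Λ₁(f) ↔ n ∣ k`, then `[Λ₀(f) : Λ₁(f)] = n` (`Λ₀/Λ₁ ≅ ℤ/n` via `k ↦ k·x`).  The first
  hypothesis is discharged from `(ℤ/N)ˣ = ±⟨d₀⟩` (`exists_sub_zsmul_mem_of_pow_cover` = the tree's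
  `exists_eq_natCast_mul_cuspSymbol_add_of_generator`, fed by an `N`-case `decide` over `d.val.Coprime N`); at the
  non-cyclic level `24` (`(ℤ/24)ˣ/±1 ≅ (ℤ/2)²`) the parabolic `P = (−11 6; −24 13)` of the cusp
  `1/2` kills the class `±13 ≡ ∓11`.
* §2 **THE VALUES** (every non-zero `f` of the level; `= #Σ(N)` of Ling–Oesterlé since the genus is one):
  **`[Λ₀ : Λ₁] = 5` at `11`, `4` at `17`, `2` at `20`, `2` at `24`, `3` at `27`, `2` at `32`**
  (`relIndex_eleven / _seventeen / _twenty / _twentyFour / _twentySeven / _thirtyTwo`), matching E15-LATTICE-INDEX-v1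
  (eclib `index_L0_L1` of `11a1, 17a1, 20a1, 24a1, 27a1, 32a1`) `6/6`; level `36` (`[Λ₀ : Λ₁] = 1` for all `f`) is
  `…ShimuraTrivialThirtySix`.
* §3 **LEVEL `52` FROM THE HECKE DATUM** (sequel to `…ShimuraEisensteinFiftyTwo`, T-es-106 part 2): for every `X₀(52)`-datum
  `D` with `(T₃ − 1)(T₃ + 3)·S₂(Γ₀(52)) ⊆ ℂ·f_D`, the class of `{∞, γ₁₅∞}` has order EXACTLY `2`
  (`zsmul_cuspSymbol_gammaFifteen_mem_iff_of_heckeDatum`) and **`[Λ₀(D.f) : Λ₁(D.f)] = 2`** (`relIndex_fiftyTwo_of_heckeDatum`;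
  `(ℤ/52)ˣ = ±⟨15⟩`; E15 row `52a1`: `2`) — the first index VALUE at a genus-`> 1` level of C2.

Kernel-checked, standard axioms, no Literature fact consumed.  Beyond print: NO (Ling–Oesterlé 1991 Thm. 1 computes `#Σ(N)`;
Mazur 1977 §II.11 for `N = 11, 17`); new in the tree: the index as a number, for every form of the level.

References: [LingOesterle1991] §1, Thm. 1; [Mazur1977] §II.11; [Stevens1989] §2; [Manin1972] Prop. 1.4, Thm. 1.9;
[CremonaAlgorithms1997] §2.8.
-/

set_option autoImplicit false

noncomputable section

-- justification: the `Summit.BirchSwinnertonDyer.BirchSwinnertonDyer.…` path repeats a component (route-file convention)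
set_option linter.dupNamespace false

open scoped Classical MatrixGroups

open CongruenceSubgroup Matrix.SpecialLinearGroup ModularGroup
open Literature.NumberTheory.EllipticCurves Literature.NumberTheory.EllipticCurves.ModularForms
open Summit.BirchSwinnertonDyer.BirchSwinnertonDyer.Theorems.ThetaLayerLambdaCongruenceAtTwo
open Summit.BirchSwinnertonDyer.BirchSwinnertonDyer.Theorems.ManinLocalTwoThree.ShimuraClass
open Summit.BirchSwinnertonDyer.BirchSwinnertonDyer.Theorems.ManinLocalTwoThree.ShimuraTwo
open Summit.BirchSwinnertonDyer.BirchSwinnertonDyer.Theorems.ManinLocalTwoThree.ShimuraThree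
open Summit.BirchSwinnertonDyer.BirchSwinnertonDyer.Theorems.ManinLocalTwoThree.ShimuraFive
open Summit.BirchSwinnertonDyer.BirchSwinnertonDyer.Theorems.ManinLocalTwoThree.ShimuraEisenstein
open Summit.BirchSwinnertonDyer.Rank1Residual.ManinAdditive.EsG45 (gammaTwo gammaTwo_apply_one_one_zmod)

namespace Summit.BirchSwinnertonDyer.BirchSwinnertonDyer.Theorems.ManinLocalTwoThree.ShimuraIndex

/-! ## §1. The index lemma -/

variable {N : ℕ} [NeZero N] (f : CuspForm (Gamma0 N) 2)

/-- **THE INDEX LEMMA.**  If every cusp symbol is an integer multiple of the period `x ∈ Λ₀(f)` modulo `Λ₁(f)` and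
`k·x ∈ Λ₁(f) ↔ n ∣ k`, then `[Λ₀(f) : Λ₁(f)] = n`: the map `k ↦ k·x` induces `ℤ/n ≅ Λ₀(f)/Λ₁(f)` (onto because every
period IS a cusp symbol, tree `coe_periodLattice_eq_range`). [cite: LingOesterle1991, §1] [cite: Stevens1989, §2] -/
theorem relIndex_eq_of_generator (x : ℂ) (hx : x ∈ periodLattice f) (n : ℕ)
    (hgen : ∀ γ : Gamma0 N, ∃ k : ℤ, cuspSymbol f γ - k * x ∈ periodLatticeGamma1 f)
    (hiff : ∀ k : ℤ, (k : ℂ) * x ∈ periodLatticeGamma1 f ↔ (n : ℤ) ∣ k) :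
    (periodLatticeGamma1 f).relIndex (periodLattice f) = n := by
  set H : AddSubgroup (periodLattice f) := (periodLatticeGamma1 f).addSubgroupOf (periodLattice f) with hH
  set ψ : ℤ →+ (periodLattice f) ⧸ H := (QuotientAddGroup.mk' H).comp (zmultiplesHom (periodLattice f) ⟨x, hx⟩) with hψdef
  have hψ : ∀ k : ℤ, ψ k = QuotientAddGroup.mk' H (k • (⟨x, hx⟩ : periodLattice f)) := fun k ↦ rfl
  have hmemH : ∀ k : ℤ, k • (⟨x, hx⟩ : periodLattice f) ∈ H ↔ (n : ℤ) ∣ k := fun k ↦ by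
    rw [hH, AddSubgroup.mem_addSubgroupOf, AddSubgroupClass.coe_zsmul, zsmul_eq_mul]
    exact hiff k
  have hsurj : Function.Surjective ψ := fun q ↦ by
    obtain ⟨z, rfl⟩ := QuotientAddGroup.mk'_surjective H q
    have hz : (z : ℂ) ∈ (periodLattice f : Set ℂ) := z.2
    rw [coe_periodLattice_eq_range] at hz
    obtain ⟨γ, hγ⟩ := hz
    obtain ⟨k, hk⟩ := hgen γ
    rw [hγ] at hk
    refine ⟨k, ?_⟩
    rw [hψ, eq_comm, ← sub_eq_zero, ← map_sub, QuotientAddGroup.mk'_apply, QuotientAddGroup.eq_zero_iff, hH,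
      AddSubgroup.mem_addSubgroupOf, AddSubgroupClass.coe_sub, AddSubgroupClass.coe_zsmul, zsmul_eq_mul]
    exact hk
  have hker : ψ.ker = AddSubgroup.zmultiples (n : ℤ) := AddSubgroup.ext fun k ↦ by
    rw [AddMonoidHom.mem_ker, hψ, QuotientAddGroup.mk'_apply, QuotientAddGroup.eq_zero_iff, hmemH, Int.mem_zmultiples_iff]
  calc (periodLatticeGamma1 f).relIndex (periodLattice f) = H.index := rfl
    _ = Nat.card ((periodLattice f) ⧸ H) := H.index_eq_card
    _ = Nat.card (ℤ ⧸ ψ.ker) := Nat.card_congr (QuotientAddGroup.quotientKerEquivOfSurjective ψ hsurj).symm.toEquiv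
    _ = Nat.card (ℤ ⧸ AddSubgroup.zmultiples (n : ℤ)) := Nat.card_congr (QuotientAddGroup.quotientAddEquivOfEq hker).toEquiv
    _ = Nat.card (ZMod n) := Nat.card_congr (Int.quotientZMultiplesNatEquivZMod n).toEquiv
    _ = n := Nat.card_zmod n

/-- `d_γ mod N` is prime to `N` for `γ ∈ Γ₀(N)`. [folklore] -/
theorem val_apply_one_one_coprime (γ : Gamma0 N) : ((((γ : SL(2, ℤ)) 1 1 : ℤ) : ZMod N)).val.Coprime N := by
  have h := ZMod.val_coe_unit_coprime (isUnit_apply_one_one γ).unit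
  rwa [IsUnit.unit_spec] at h

/-- **Cyclic cover.**  If `(ℤ/N)ˣ = ±{d₀ᵏ : k < m}` with `d₀ = d_{γ₀}` (stated over `d.val.Coprime N`: an `N`-case `decide`),
then every cusp symbol is an integer multiple of `{∞, γ₀∞}_f` modulo `Λ₁(f)` — the tree's
`exists_eq_natCast_mul_cuspSymbol_add_of_generator` (`Λ₀(f) = ℤ·{∞, γ₀∞}_f + Λ₁(f)`). [cite: LingOesterle1991, §1] -/
theorem exists_sub_zsmul_mem_of_pow_cover (γ₀ : Gamma0 N) (d₀ : ZMod N) (hγ₀ : (((γ₀ : SL(2, ℤ)) 1 1 : ℤ) : ZMod N) = d₀)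
    {m : ℕ} (hcyc : ∀ d : ZMod N, d.val.Coprime N → ∃ k < m, d = d₀ ^ k ∨ d = -(d₀ ^ k)) (γ : Gamma0 N) :
    ∃ k : ℤ, cuspSymbol f γ - k * cuspSymbol f γ₀ ∈ periodLatticeGamma1 f := by
  obtain ⟨k, w, hw, hk⟩ := exists_eq_natCast_mul_cuspSymbol_add_of_generator f
    (fun u ↦ (hcyc (u : ZMod N) (ZMod.val_coe_unit_coprime u)).imp fun _ hk ↦ hk.2) γ₀ hγ₀ (cuspSymbol_mem_periodLattice f γ)
  exact ⟨k, by rw [hk]; push_cast; simpa using hw⟩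

/-! ## §2. The values -/

/-- `(ℤ/11)ˣ = ±{2ᵏ : k < 5}`. [folklore] -/
theorem units_eleven : ∀ d : ZMod 11, d.val.Coprime 11 → ∃ k < 5, d = 2 ^ k ∨ d = -(2 ^ k) := by decide

/-- `(ℤ/17)ˣ = ±{3ᵏ : k < 8}`. [folklore] -/
theorem units_seventeen : ∀ d : ZMod 17, d.val.Coprime 17 → ∃ k < 8, d = 3 ^ k ∨ d = -(3 ^ k) := by decide

/-- `(ℤ/20)ˣ = ±{7ᵏ : k < 4}`. [folklore] -/
theorem units_twenty : ∀ d : ZMod 20, d.val.Coprime 20 → ∃ k < 4, d = 7 ^ k ∨ d = -(7 ^ k) := by decide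

/-- `(ℤ/27)ˣ = ±{2ᵏ : k < 9}`. [folklore] -/
theorem units_twentySeven : ∀ d : ZMod 27, d.val.Coprime 27 → ∃ k < 9, d = 2 ^ k ∨ d = -(2 ^ k) := by decide

/-- `(ℤ/32)ˣ = ±{5ᵏ : k < 8}`. [folklore] -/
theorem units_thirtyTwo : ∀ d : ZMod 32, d.val.Coprime 32 → ∃ k < 8, d = 5 ^ k ∨ d = -(5 ^ k) := by decide

/-- `(ℤ/24)ˣ = {±1, ±5, ±13, ±17}`. [folklore] -/
theorem units_twentyFour : ∀ d : ZMod 24, d.val.Coprime 24 →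
    (d = 1 ∨ d = -1) ∨ (d = 5 ∨ d = -5) ∨ (d = 13 ∨ d = -13) ∨ (d = 17 ∨ d = -17) := by decide

/-! ### Level `11`: `[Λ₀ : Λ₁] = 5` -/

/-- **`k·{∞, γ₂∞}_f ∈ Λ₁(f) ↔ 5 ∣ k`** at level `11` (`f ≠ 0`, `γ₂ = (6 1; 11 2)`): the ℤ/5-class `χ₁₁` (T-es-101) sees `k` prime to `5`,
and `2⁵ ≡ −1 (mod 11)` gives `5{∞, γ₂∞} ∈ Λ₁`. [cite: Mazur1977, §II.11] -/
theorem zsmul_cuspSymbol_gammaTwo_mem_iff_eleven (f : CuspForm (Gamma0 11) 2) (hf : f ≠ 0) (k : ℤ) :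
    (k : ℂ) * cuspSymbol f gammaTwo ∈ periodLatticeGamma1 f ↔ (5 : ℤ) ∣ k := by
  constructor
  · intro h
    by_contra hnd
    obtain ⟨φ, hφ⟩ := exists_shimuraHom_eleven
    have hv : ∀ γ₁ : Gamma1 11, shimuraChar (((((⟨(γ₁ : SL(2, ℤ)), Gamma1_in_Gamma0 11 γ₁.2⟩ : Gamma0 11) : SL(2, ℤ)) 1 1 :
        ℤ) : ZMod 11)) = 0 := fun γ₁ ↦ by
      rw [show (((((⟨(γ₁ : SL(2, ℤ)), Gamma1_in_Gamma0 11 γ₁.2⟩ : Gamma0 11) : SL(2, ℤ)) 1 1 : ℤ) : ZMod 11)) = 1 from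
        ((Gamma1_mem 11 _).mp γ₁.2).2.1, shimuraChar_one]
    refine zsmul_cuspSymbol_not_mem_of_hom φ _ hφ hv f
      ((finrank_eq_one_iff_of_nonzero' f hf).mp finrank_cuspForm_two_eq_genusX0_eleven.2.1) gammaTwo k ?_ h
    rw [gammaTwo_apply_one_one_zmod, shimuraChar_two, zsmul_one]
    exact fun h0 ↦ hnd ((ZMod.intCast_zmod_eq_zero_iff_dvd k 5).mp h0)
  · rintro ⟨m, rfl⟩
    rw [Int.cast_mul, show ((5 : ℤ) : ℂ) = (5 : ℕ) by norm_num, mul_comm ((5 : ℕ) : ℂ) (m : ℂ), mul_assoc, ← zsmul_eq_mul]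
    exact (periodLatticeGamma1 f).zsmul_mem (natCast_mul_cuspSymbol_mem_periodLatticeGamma1_of_pow_apply f gammaTwo 5
      (Or.inr (by rw [gammaTwo_apply_one_one_zmod]; decide))) m

/-- **`[Λ₀(f) : Λ₁(f)] = 5` AT LEVEL `11`** for every non-zero `f ∈ S₂(Γ₀(11))` (`= #Σ(11) = num((11−1)/12)·… = 5`, Mazur; E15 `11a1`: `5`).
[cite: Mazur1977, §II.11] [cite: LingOesterle1991, Thm. 1] -/
theorem relIndex_eleven (f : CuspForm (Gamma0 11) 2) (hf : f ≠ 0) : (periodLatticeGamma1 f).relIndex (periodLattice f) = 5 :=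
  relIndex_eq_of_generator f _ (cuspSymbol_mem_periodLattice f gammaTwo) 5
    (exists_sub_zsmul_mem_of_pow_cover f gammaTwo 2 gammaTwo_apply_one_one_zmod units_eleven)
    (zsmul_cuspSymbol_gammaTwo_mem_iff_eleven f hf)

/-! ### Level `17`: `[Λ₀ : Λ₁] = 4` -/

/-- **`[Λ₀(f) : Λ₁(f)] = 4` AT LEVEL `17`** for every non-zero `f` (`= #Σ(17) = num((17−1)/12·…) = 4`; E15 `17a1`: `4`, snf `[4, 1]`).
[cite: Mazur1977, §II.11] [cite: LingOesterle1991, Thm. 1] -/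
theorem relIndex_seventeen (f : CuspForm (Gamma0 17) 2) (hf : f ≠ 0) : (periodLatticeGamma1 f).relIndex (periodLattice f) = 4 :=
  relIndex_eq_of_generator f _ (cuspSymbol_mem_periodLattice f gammaThree) 4
    (exists_sub_zsmul_mem_of_pow_cover f gammaThree 3 (by rw [show (((gammaThree : SL(2, ℤ)) 1 1 : ℤ)) = 3 from rfl]; decide)
      units_seventeen)
    (zsmul_cuspSymbol_gammaThree_mem_iff_seventeen f hf)

/-! ### Level `20`: `[Λ₀ : Λ₁] = 2` -/

/-- **`[Λ₀(f) : Λ₁(f)] = 2` AT LEVEL `20`** for every non-zero `f` (`= #Σ(20)`; E15 `20a1`: `2`). [cite: LingOesterle1991, Thm. 1] -/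
theorem relIndex_twenty (f : CuspForm (Gamma0 20) 2) (hf : f ≠ 0) : (periodLatticeGamma1 f).relIndex (periodLattice f) = 2 :=
  relIndex_eq_of_generator f _ (cuspSymbol_mem_periodLattice f gammaSeven) 2
    (exists_sub_zsmul_mem_of_pow_cover f gammaSeven 7 (by rw [show (((gammaSeven : SL(2, ℤ)) 1 1 : ℤ)) = 7 from rfl]; decide)
      units_twenty)
    (zsmul_cuspSymbol_gammaSeven_mem_iff_twenty f hf)

/-! ### Level `24`: `[Λ₀ : Λ₁] = 2` (non-cyclic units; the parabolic of the cusp `1/2`) -/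

/-- The parabolic `P = (−11 6; −24 13) = k (1 6; 0 1) k⁻¹ ∈ Γ₀(24)`, `k = (1 0; 2 1)`, fixing the cusp `1/2`; `d_P = 13`. [folklore] -/
def parabolicHalf24 : Gamma0 24 :=
  ⟨⟨!![-11, 6; -24, 13], by rw [Matrix.det_fin_two_of]; norm_num⟩, by
    rw [Gamma0_mem]
    show (((-24 : ℤ) : ZMod 24)) = 0
    decide⟩

/-- `{∞, P∞} = 0` in `S₂(Γ₀(24))^∨` (cusp stabiliser; `k, k⁻¹` are the tree's `kHalf, kHalfInv`). [cite: Manin1972, §1.5] -/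
theorem periodFunctional_parabolicHalf24 : periodFunctional 24 parabolicHalf24 = 0 := by
  refine periodFunctional_eq_zero_of_conj_upper parabolicHalf24 kHalf ?_
  rw [inv_eq_of_mul_eq_one_right kHalf_mul_inv]
  rfl

/-- At level `24` every cusp symbol is `≡ 0` or `≡ {∞, γ₅∞}_f (mod Λ₁(f))`: `±1, ±13 ↦ 0` (`13 = d_P`), `±5, ±17 ↦ 1` (`17 ≡ 5·13`).
[cite: LingOesterle1991, §1] -/
theorem exists_sub_zsmul_mem_twentyFour (f : CuspForm (Gamma0 24) 2) (γ : Gamma0 24) :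
    ∃ k : ℤ, cuspSymbol f γ - k * cuspSymbol f gammaFiveLevel24 ∈ periodLatticeGamma1 f := by
  have hP : cuspSymbol f parabolicHalf24 = 0 := by
    rw [← periodFunctional_apply, periodFunctional_parabolicHalf24, LinearMap.zero_apply]
  have h5 : (((gammaFiveLevel24 : SL(2, ℤ)) 1 1 : ℤ)) = 5 := rfl
  have h13 : (((parabolicHalf24 : SL(2, ℤ)) 1 1 : ℤ)) = 13 := rfl
  have h17 : ((((gammaFiveLevel24 * parabolicHalf24 : Gamma0 24) : SL(2, ℤ)) 1 1 : ℤ) : ZMod 24) = 17 := by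
    have h := map_mul (Gamma0Map 24) gammaFiveLevel24 parabolicHalf24
    rw [show Gamma0Map 24 gammaFiveLevel24 = (((gammaFiveLevel24 : SL(2, ℤ)) 1 1 : ℤ) : ZMod 24) from rfl, h5,
      show Gamma0Map 24 parabolicHalf24 = (((parabolicHalf24 : SL(2, ℤ)) 1 1 : ℤ) : ZMod 24) from rfl, h13] at h
    exact h.trans (by decide)
  have hprod : cuspSymbol f (gammaFiveLevel24 * parabolicHalf24) = cuspSymbol f gammaFiveLevel24 := by
    rw [cuspSymbol_mul_holds f, hP, add_zero]
  rcases units_twentyFour _ (val_apply_one_one_coprime γ) with (h | h) | (h | h) | (h | h) | (h | h)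
  · exact ⟨0, by simpa using cuspSymbol_mem_periodLatticeGamma1_of_apply_eq_one f γ h⟩
  · exact ⟨0, by simpa using cuspSymbol_mem_periodLatticeGamma1_of_apply_eq_neg_one f γ h⟩
  · exact ⟨1, by simpa using cuspSymbol_sub_mem_periodLatticeGamma1_of_apply_eq f gammaFiveLevel24 γ (by rw [h5, h]; decide)⟩
  · exact ⟨1, by
      simpa using cuspSymbol_sub_mem_periodLatticeGamma1_of_apply_eq_neg f gammaFiveLevel24 γ (by rw [h5, h]; decide)⟩
  · refine ⟨0, ?_⟩
    simpa [hP] using cuspSymbol_sub_mem_periodLatticeGamma1_of_apply_eq f parabolicHalf24 γ (by rw [h13, h]; decide)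
  · refine ⟨0, ?_⟩
    simpa [hP] using cuspSymbol_sub_mem_periodLatticeGamma1_of_apply_eq_neg f parabolicHalf24 γ (by rw [h13, h]; decide)
  · refine ⟨1, ?_⟩
    simpa [hprod] using cuspSymbol_sub_mem_periodLatticeGamma1_of_apply_eq f (gammaFiveLevel24 * parabolicHalf24) γ
      (by rw [h17, h])
  · refine ⟨1, ?_⟩
    simpa [hprod] using cuspSymbol_sub_mem_periodLatticeGamma1_of_apply_eq_neg f (gammaFiveLevel24 * parabolicHalf24) γ
      (by rw [h17, h])

/-- **`[Λ₀(f) : Λ₁(f)] = 2` AT LEVEL `24`** for every non-zero `f` (`= #Σ(24)`; E15 `24a1`: `2`). [cite: LingOesterle1991, Thm. 1] -/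
theorem relIndex_twentyFour (f : CuspForm (Gamma0 24) 2) (hf : f ≠ 0) :
    (periodLatticeGamma1 f).relIndex (periodLattice f) = 2 :=
  relIndex_eq_of_generator f _ (cuspSymbol_mem_periodLattice f gammaFiveLevel24) 2 (exists_sub_zsmul_mem_twentyFour f)
    (zsmul_cuspSymbol_gammaFive_mem_iff_twentyFour f hf)

/-! ### Level `27`: `[Λ₀ : Λ₁] = 3` -/

/-- **`[Λ₀(f) : Λ₁(f)] = 3` AT LEVEL `27`** for every non-zero `f` (`= #Σ(27)`; E15 `27a1`: `3`, snf `[3, 1]`) — the C3 value.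
[cite: LingOesterle1991, Thm. 1] [cite: Stevens1989, §2] -/
theorem relIndex_twentySeven (f : CuspForm (Gamma0 27) 2) (hf : f ≠ 0) :
    (periodLatticeGamma1 f).relIndex (periodLattice f) = 3 :=
  relIndex_eq_of_generator f _ (cuspSymbol_mem_periodLattice f gammaTwo27) 3
    (exists_sub_zsmul_mem_of_pow_cover f gammaTwo27 2 (by rw [show (((gammaTwo27 : SL(2, ℤ)) 1 1 : ℤ)) = 2 from rfl]; decide)
      units_twentySeven)
    (zsmul_cuspSymbol_gammaTwo_mem_iff_twentySeven f hf)

/-! ### Level `32`: `[Λ₀ : Λ₁] = 2` -/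

/-- **`[Λ₀(f) : Λ₁(f)] = 2` AT LEVEL `32`** for every non-zero `f` (`= #Σ(32)`; E15 `32a1`: `2`). [cite: LingOesterle1991, Thm. 1] -/
theorem relIndex_thirtyTwo (f : CuspForm (Gamma0 32) 2) (hf : f ≠ 0) :
    (periodLatticeGamma1 f).relIndex (periodLattice f) = 2 :=
  relIndex_eq_of_generator f _ (cuspSymbol_mem_periodLattice f gammaFiveLevel32) 2
    (exists_sub_zsmul_mem_of_pow_cover f gammaFiveLevel32 5
      (by rw [show (((gammaFiveLevel32 : SL(2, ℤ)) 1 1 : ℤ)) = 5 from rfl]; decide) units_thirtyTwo)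
    (zsmul_cuspSymbol_gammaFive_mem_iff_thirtyTwo f hf)

/-! ## §3. Level `52` from the Hecke datum: `[Λ₀ : Λ₁] = 2` -/

/-- **ORDER EXACTLY `2` AT LEVEL `52` FROM THE HECKE DATUM**: for every `X₀(52)`-datum `D` with
`(T₃ − 1)(T₃ + 3)·S₂(Γ₀(52)) ⊆ ℂ·f_D`, `n·{∞, γ₁₅∞}_f ∈ Λ₁(f) ↔ 2 ∣ n` (`f = D.f`; `⇒`: the `ℤ/2`-class `φ₁₃` and the
transparent separator of odd multiplier `21`, tree `zsmul_cuspSymbol_not_mem_of_transparent_separator`; `⇐`: `2Λ₀(f) ⊆ Λ₁(f)`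
at `4 ∣ N`). [cite: CremonaAlgorithms1997, Tables 3 and 5] [cite: LingOesterle1991, Thm. 1] -/
theorem zsmul_cuspSymbol_gammaFifteen_mem_iff_of_heckeDatum (W : WeierstrassCurve ℚ) [W.IsElliptic]
    (D : ModularParametrizationData W 52)
    (hsep : ∀ g : CuspForm (Gamma0 52) 2, ∃ c : ℂ, separatorFiftyTwo g = c • D.f) (n : ℤ) :
    (n : ℂ) * cuspSymbol D.f gammaFifteen ∈ periodLatticeGamma1 D.f ↔ (2 : ℤ) ∣ n := by
  constructor
  · intro h
    by_contra hnd
    obtain ⟨φ, hφ⟩ := exists_shimuraHom_fiftyTwo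
    have hv : ∀ γ₁ : Gamma1 52, charThirteen (((((⟨(γ₁ : SL(2, ℤ)), Gamma1_in_Gamma0 52 γ₁.2⟩ : Gamma0 52) : SL(2, ℤ)) 1 1 :
        ℤ) : ZMod 13)) = 0 := fun γ₁ ↦ char_apply_gamma1 (by norm_num) charThirteen (by decide) γ₁
    obtain ⟨m, e⟩ := transparent_separatorFiftyTwo φ _ hφ hv
    refine zsmul_cuspSymbol_not_mem_of_transparent_separator φ _ hφ hv D.f m e (by decide) hsep gammaFifteen n ?_ h
    rw [show (((gammaFifteen : SL(2, ℤ)) 1 1 : ℤ)) = 15 from rfl, show charThirteen (((15 : ℤ)) : ZMod 13) = 1 by decide,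
      zsmul_one]
    exact fun h0 ↦ hnd ((ZMod.intCast_zmod_eq_zero_iff_dvd n 2).mp h0)
  · rintro ⟨k, rfl⟩
    rw [Int.cast_mul, show ((2 : ℤ) : ℂ) = 2 by norm_num, mul_comm (2 : ℂ) (k : ℂ), mul_assoc, ← zsmul_eq_mul]
    exact (periodLatticeGamma1 D.f).zsmul_mem
      (two_mul_mem_periodLatticeGamma1_of_four_dvd D (by norm_num) (cuspSymbol_mem_periodLattice D.f gammaFifteen)) k

/-- `(ℤ/52)ˣ = ±{15ᵏ : k < 12}` (`15` has order `12` modulo `52` and `−1 ∉ ⟨15⟩`). [folklore] -/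
theorem units_fiftyTwo : ∀ d : ZMod 52, d.val.Coprime 52 → ∃ k < 12, d = 15 ^ k ∨ d = -(15 ^ k) := by decide

/-- **`[Λ₀(f) : Λ₁(f)] = 2` AT LEVEL `52` FROM THE HECKE DATUM** (`f = D.f`, every `X₀(52)`-datum `D` with the Hecke datum;
E15 row `52a1`: eclib `index_L0_L1 = 2`): every cusp symbol is an integer multiple of `{∞, γ₁₅∞}_f` modulo `Λ₁(f)`
(`(ℤ/52)ˣ = ±⟨15⟩`) and that class has order exactly `2`. [cite: CremonaAlgorithms1997, §2.8, Tables 3 and 5]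
[cite: LingOesterle1991, §1] -/
theorem relIndex_fiftyTwo_of_heckeDatum (W : WeierstrassCurve ℚ) [W.IsElliptic] (D : ModularParametrizationData W 52)
    (hsep : ∀ g : CuspForm (Gamma0 52) 2, ∃ c : ℂ, separatorFiftyTwo g = c • D.f) :
    (periodLatticeGamma1 D.f).relIndex (periodLattice D.f) = 2 :=
  relIndex_eq_of_generator D.f _ (cuspSymbol_mem_periodLattice D.f gammaFifteen) 2
    (exists_sub_zsmul_mem_of_pow_cover D.f gammaFifteen 15
      (by rw [show (((gammaFifteen : SL(2, ℤ)) 1 1 : ℤ)) = 15 from rfl]; decide) units_fiftyTwo)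
    (zsmul_cuspSymbol_gammaFifteen_mem_iff_of_heckeDatum W D hsep)

end Summit.BirchSwinnertonDyer.BirchSwinnertonDyer.Theorems.ManinLocalTwoThree.ShimuraIndex
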